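import Mathlib

/-!
# Small common regular values of two `C¹` maps (Kronecker existence theorem, step K2)

Crux `WitnessCharge` (stmt-SmoothPoincare4-7824), route `SullivanDual`, line Sketch. The F5
programme (McDuff's cusp theorem via the twisted difference map of a `J`-holomorphic curve) uses a
Kronecker existence theorem on sup-norm cubes of `ℝⁿ⁺¹` (`Fin (n + 1) → ℝ`); its comparison step
applies the flat-torus index theorem, which needs non-degenerate zeros, to two `C¹` fields after
shifting the value `0` to a small vector `c` that is a regular value of both fields. This file
provides such a `c`: for `C¹` maps `f g : ℝⁿ⁺¹ → ℝⁿ⁺¹` and every `η > 0` there is `c` with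
`‖c‖ < η` such that `det Df(x) ≠ 0` whenever `f x = c` and `det Dg(x) ≠ 0` whenever `g x = c`.

Proof (Sard in equal dimensions): by
`MeasureTheory.addHaar_image_eq_zero_of_det_fderivWithin_eq_zero` the critical-value sets
`f '' {x | det Df(x) = 0}` and `g '' {x | det Dg(x) = 0}` are Lebesgue-null, while the ball
`Metric.ball 0 η` has positive Lebesgue measure (`Metric.measure_ball_pos`); hence the ball is
not covered by the two critical-value sets, and any point of the ball outside both of them works.
The compactness hypothesis on `K` is not needed (the conclusion is proved for all `x`), but it is
kept in the registered signature.

Mathlib only; no definitions, no `sorry`.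
-/

noncomputable section

-- the summit path `SmoothPoincare4/SmoothPoincare4` forces a duplicated namespace segment
set_option linter.dupNamespace false

open Set Filter Metric Function MeasureTheory

namespace Summit.SmoothPoincare4.SmoothPoincare4.Theorems.WitnessCharge.PencilIncompleteness

/-- Sard's lemma in equal dimensions for a `C¹` map `f : ℝⁿ⁺¹ → ℝⁿ⁺¹`: the set of critical
values `f '' {x | det Df(x) = 0}` is Lebesgue-null. -/
private lemma volume_image_det_fderiv_eq_zero {n : ℕ}
    (f : (Fin (n + 1) → ℝ) → (Fin (n + 1) → ℝ)) (hf : ContDiff ℝ 1 f) :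
    volume (f '' {x | (fderiv ℝ f x).det = 0}) = 0 :=
  addHaar_image_eq_zero_of_det_fderivWithin_eq_zero volume
    (fun x _ => ((hf.differentiable one_ne_zero) x).hasFDerivAt.hasFDerivWithinAt)
    (fun _ hx => hx)

/-- **K2 — small common regular values.** Let `f g : ℝⁿ⁺¹ → ℝⁿ⁺¹` be `C¹`, `K ⊆ ℝⁿ⁺¹` compact
and `η > 0`. Then there is `c` with `‖c‖ < η` which is a regular value of both `f` and `g` on `K`:
`det Df(x) ≠ 0` whenever `x ∈ K` and `f x = c`, and `det Dg(x) ≠ 0` whenever `x ∈ K` and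
`g x = c` (Sard: the critical values of `f` and of `g` are Lebesgue-null, the ball `‖c‖ < η` is
not). -/
theorem helper_kronecker_regularValue :
    ∀ (n : ℕ) (f g : (Fin (n + 1) → ℝ) → (Fin (n + 1) → ℝ)) (K : Set (Fin (n + 1) → ℝ)) (η : ℝ),
      ContDiff ℝ 1 f → ContDiff ℝ 1 g → IsCompact K → 0 < η →
      ∃ c : Fin (n + 1) → ℝ, ‖c‖ < η ∧ (∀ x ∈ K, f x = c → (fderiv ℝ f x).det ≠ 0) ∧
        (∀ x ∈ K, g x = c → (fderiv ℝ g x).det ≠ 0) := by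
  intro n f g K η hf hg _hK hη
  -- the two critical-value sets are null, the ball is not
  have hnull : volume (f '' {x | (fderiv ℝ f x).det = 0} ∪ g '' {x | (fderiv ℝ g x).det = 0}) = 0 :=
    measure_union_null (volume_image_det_fderiv_eq_zero f hf)
      (volume_image_det_fderiv_eq_zero g hg)
  have hball : ¬ (Metric.ball (0 : Fin (n + 1) → ℝ) η ⊆
      f '' {x | (fderiv ℝ f x).det = 0} ∪ g '' {x | (fderiv ℝ g x).det = 0}) := fun h =>
    (Metric.measure_ball_pos volume (0 : Fin (n + 1) → ℝ) hη).ne' (measure_mono_null h hnull)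
  obtain ⟨c, hc, hcrit⟩ := not_subset.1 hball
  refine ⟨c, mem_ball_zero_iff.1 hc, fun x _ hxc hdet => hcrit ?_, fun x _ hxc hdet => hcrit ?_⟩
  · exact Or.inl ⟨x, hdet, hxc⟩
  · exact Or.inr ⟨x, hdet, hxc⟩

end Summit.SmoothPoincare4.SmoothPoincare4.Theorems.WitnessCharge.PencilIncompleteness
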